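import Summits.ValiantsHypothesis.ValiantsHypothesis.Theorems.FreeSubtorusOrbitDimensionBoundSlices
import Summits.ValiantsHypothesis.ValiantsHypothesis.Theorems.RigidMinimalRepsTorusBound
import Literature.Computability.AlgebraicComplexity.PermanentVsDeterminantProofs

/-!
# Calibration of crux `FreeSubtorus.OrbitDimensionBound` (stmt-ValiantsHypothesis-16133), line `Sketch`

Lead prover's calibration work file (crux workfile `Calibration.lean`; sorry-free).  It places the crux
between two named statements and records what the line's single open stub is worth.

* `relTorus_zero_eq_twoSided` — for the EMPTY family of relations (`r = 0`) the crux's subtorus `T_∅`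
  (generator form over `ℂˣ`) IS the tree's two-sided torus (generator form over `ℂ`, stmt-4164 /
  Grenet), as subgroups of `GL(n²)`.
* `orbitDimensionBoundR0At_iff_grenetOptimal` — **the `r = 0` slice of the crux at `n ≥ 3` is
  EQUIVALENT to Grenet optimality `dc(per_n) = 2ⁿ - 1`**: (⇒) an optimal representation made
  `T'`-equivariant has size `≥ 2ⁿ - 1` by the PROVED sibling crux `TorusBound`
  (`RigidMinimalRepsTorusBound.torusBound_proof`), and `≤` is Grenet; (⇐) pad Grenet.
* `orbitDimensionBound_of_grenetOptimal` — **Grenet optimality for all `n ≥ 4` implies the crux**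
  (with `r = 0`; the slice `n = 3` is the landed `orbitDimensionBound_three`).  So the crux sits in the
  sandwich  `GrenetOptimal ⇒ OrbitDimensionBound ⇒ HomothetySymmetrisation`
  (`homothetyLifts_of_orbitDimensionBound`, landed), both ends open for `n ≥ 4`.
* `SmallFaceOfEquivariant` (a `Prop`, the CONVERSE CALIBRATION of the line, not proved here): a
  `T_Λ`-equivariant representation is, after a CONSTANT gauge, tight modulo the saturation of `ℤΛ`
  — so the registered open stub `stub_smallFace` is equivalent to the crux's open range and carries no
  residual content below it.  Proof sketch in the docstring (one generic element of `T_Λ°`, its single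
  exact lift, bases adapted to generalised eigenspaces, a spanning forest of the support graph).
-/

-- Sub = Summit single-conjunct layout: the duplicated namespace component is mandated by the tree.
set_option linter.dupNamespace false

noncomputable section

namespace Summit.ValiantsHypothesis.ValiantsHypothesis.Cruxes.OrbitDimensionBound.Calibration

open Matrix MvPolynomial Finset
open Literature.Computability.AlgebraicComplexity
open Summit.ValiantsHypothesis.ValiantsHypothesis.Theorems.FreeSubtorusOrbitDimensionBound

/-! ### `r = 0`: the crux's subtorus is the two-sided torus -/

/-- For the empty family of relations the crux's subtorus (generators `diag(d_k e_l)`, `d, e` units)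
coincides with the two-sided torus in the tree's generator form (`d, e : Fin n → ℂ`, automatically
nonvanishing since the generator is invertible). [folklore] -/
theorem relTorus_zero_eq_twoSided (n : ℕ) :
    Subgroup.closure {γ : GL (Fin n × Fin n) ℂ | ∃ d e : Fin n → ℂˣ,
        (∀ i : Fin 0, (∏ k, (d k) ^ (Fin.elim0 i : Fin n ⊕ Fin n → ℤ) (Sum.inl k)) *
          (∏ l, (e l) ^ (Fin.elim0 i : Fin n ⊕ Fin n → ℤ) (Sum.inr l)) = 1) ∧
        (γ : Matrix (Fin n × Fin n) (Fin n × Fin n) ℂ) = Matrix.diagonal (fun p => (d p.1 : ℂ) * (e p.2 : ℂ))} =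
    Subgroup.closure {γ : GL (Fin n × Fin n) ℂ | ∃ d e : Fin n → ℂ,
        (γ : Matrix (Fin n × Fin n) (Fin n × Fin n) ℂ) = Matrix.diagonal (fun p => d p.1 * e p.2)} := by
  refine le_antisymm (Subgroup.closure_mono ?_) (Subgroup.closure_mono ?_)
  · rintro γ ⟨d, e, -, hγ⟩
    exact ⟨fun k => (d k : ℂ), fun l => (e l : ℂ), hγ⟩
  · rintro γ ⟨d, e, hγ⟩
    have hdet : (γ : Matrix (Fin n × Fin n) (Fin n × Fin n) ℂ).det ≠ 0 := by
      rw [← Matrix.GeneralLinearGroup.val_det_apply]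
      exact Units.ne_zero _
    rw [hγ, Matrix.det_diagonal] at hdet
    have hne : ∀ i j : Fin n, d i * e j ≠ 0 := fun i j =>
      Finset.prod_ne_zero_iff.1 hdet (i, j) (Finset.mem_univ _)
    refine ⟨fun k => Units.mk0 (d k) (fun h => ?_), fun l => Units.mk0 (e l) (fun h => ?_),
      fun i => i.elim0, by simpa using hγ⟩
    · exact hne k k (by rw [h, zero_mul])
    · exact hne l l (by rw [h, mul_zero])

/-! ### The `r = 0` slice of the crux is Grenet optimality -/

/-- The `r = 0` slice of the crux at `n`: every size `m ≥ dc(per_n)` carries a representation that is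
equivariant under the FULL two-sided torus (empty family of relations). [folklore] -/
def OrbitDimensionBoundR0At (n : ℕ) : Prop :=
  ∀ (m : ℕ) (A : Matrix (Fin m) (Fin m) (MvPolynomial (Fin n × Fin n) ℂ)),
    IsAffineDetRepr (perPoly (Fin n) ℂ) A →
    ∃ B : Matrix (Fin m) (Fin m) (MvPolynomial (Fin n × Fin n) ℂ),
      IsEquivariantDetRepr (Subgroup.closure {γ : GL (Fin n × Fin n) ℂ | ∃ d e : Fin n → ℂˣ,
        (∀ i : Fin 0, (∏ k, (d k) ^ (Fin.elim0 i : Fin n ⊕ Fin n → ℤ) (Sum.inl k)) *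
          (∏ l, (e l) ^ (Fin.elim0 i : Fin n ⊕ Fin n → ℤ) (Sum.inr l)) = 1) ∧
        (γ : Matrix (Fin n × Fin n) (Fin n × Fin n) ℂ) = Matrix.diagonal (fun p => (d p.1 : ℂ) * (e p.2 : ℂ))})
        (perPoly (Fin n) ℂ) B

/-- **The `r = 0` slice at `n ≥ 3` is EQUIVALENT to Grenet optimality `dc(per_n) = 2ⁿ - 1`.**
(⇒) Apply it to an optimal representation (`hasDetRepr_determinantalComplexity_holds`): the resulting
two-sided-torus-equivariant representation of size `dc(per_n)` has size `≥ 2ⁿ - 1` by the PROVED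
`TorusBound` (`RigidMinimalRepsTorusBound.torusBound_proof`, via `RigidityForcesSymmetry.TorusBound`);
`≤` is Grenet (`determinantalComplexity_perPoly_le_holds`).  (⇐) every representation has size
`m ≥ dc = 2ⁿ - 1`, so the padded Grenet representation serves (`concl_of_two_pow_le`'s engine).
[cite: LandsbergRessayre2017, Thm. 2.8] [cite: Grenet2011, Thm. 1] -/
theorem orbitDimensionBoundR0At_iff_grenetOptimal {n : ℕ} (hn : 3 ≤ n) :
    OrbitDimensionBoundR0At n ↔ determinantalComplexity (perPoly (Fin n) ℂ) = 2 ^ n - 1 := by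
  have hup : determinantalComplexity (perPoly (Fin n) ℂ) ≤ 2 ^ n - 1 :=
    determinantalComplexity_perPoly_le_holds ℂ n (by omega)
  constructor
  · intro h
    obtain ⟨A, hA⟩ := hasDetRepr_determinantalComplexity_holds (perPoly (Fin n) ℂ)
    obtain ⟨B, hB⟩ := h _ A hA
    rw [relTorus_zero_eq_twoSided] at hB
    have hlow : 2 ^ n - 1 ≤ determinantalComplexity (perPoly (Fin n) ℂ) :=
      Summit.ValiantsHypothesis.ValiantsHypothesis.Theorems.BorderApolarityToricWitnessObstructionQP.stub_torusBound
        n hn _ B hB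
    exact le_antisymm hup hlow
  · intro hdc m A hA
    have hm : 2 ^ n - 1 ≤ m := hdc ▸ determinantalComplexity_le_of_hasDetRepr ⟨A, hA⟩
    obtain ⟨B, hB⟩ := HasEquivariantDetRepr.of_le
      (Grenet.hasEquivariantDetRepr_perPoly_twoSidedTorus ℂ (n := n) (by omega)) hm
    refine ⟨B, ?_⟩
    rw [relTorus_zero_eq_twoSided]
    exact hB

/-- **Grenet optimality for every `n ≥ 4` implies the crux** (with `r = 0`; the slice `n = 3` is the
landed `orbitDimensionBound_three`): if `dc(per_n) = 2ⁿ - 1` then every representation has a Grenet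
size and the padded Grenet representation is two-sided-torus equivariant.
[cite: Grenet2011, Thm. 1] [cite: LandsbergRessayre2017, §2 Q2.2] -/
theorem orbitDimensionBound_of_grenetOptimal
    (h : ∀ n : ℕ, 4 ≤ n → determinantalComplexity (perPoly (Fin n) ℂ) = 2 ^ n - 1) :
    Summit.ValiantsHypothesis.ValiantsHypothesis.Theses.FreeSubtorus.OrbitDimensionBound := by
  refine orbitDimensionBound_of_four_le fun n hn m A hA => ?_
  have hm : 2 ^ n - 1 ≤ m := h n hn ▸ determinantalComplexity_le_of_hasDetRepr ⟨A, hA⟩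
  exact concl_of_two_pow_le (by omega) hm

/-! ### The converse calibration of the line (statement) -/

/-- **Converse calibration of line `Sketch` (statement only).**  If a size-`m` affine determinantal
representation `B` of `per_n` is `T_Λ`-equivariant (exact lifts), then some CONSTANT gauge transform
`P · B · Q` (`P, Q ∈ GL_m(ℂ)`, `det P · det Q = 1`) is tight modulo the SATURATION `Λ'` of `ℤΛ` for
suitable potentials `α, β` — hence `stub_smallFace` (with `μ = 0`, `a = b = 0`, and `Λ'`, which is again
admissible of rank `≤ r`) follows from the crux on its open range, i.e. the stub is EQUIVALENT to the
crux there.  Proof sketch (not formalised; L-sized): choose a cocharacter `ν ⟂ Λ` with `⟨ν, v⟩ ≠ 0` for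
every `v ∉ ℚΛ` of sup-norm `≤ 4m + 1` (a rational subspace is not a finite union of hyperplane traces),
put `t₀ = ν(2) ∈ T_Λ°`, take ONE exact lift `B(t₀·x) = P B Q`; coefficientwise `P B_s = χ_s(t₀) B_s Q⁻¹`,
so `B_s` maps the generalised `μ`-eigenspace of `Q⁻¹` into the generalised `χ_s(t₀)μ`-eigenspace of
`P`; in bases adapted to both decompositions an entry `(i,j)` carries only monomials `s` with
`λ_i = χ_s(t₀) μ_j`; potentials along a spanning forest of the support graph and the genericity of `t₀`
(`2^k = 1 ⇒ k = 0`) turn these multiplicative identities into `wt s - α_i - β_j ∈ Λ_sat`.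
[cite: LandsbergRessayre2017, §3] -/
def SmallFaceOfEquivariant : Prop :=
  ∀ (n m r : ℕ) (Λ : Fin r → (Fin n ⊕ Fin n) → ℤ) (B : Matrix (Fin m) (Fin m) (MvPolynomial (Fin n × Fin n) ℂ)),
    IsEquivariantDetRepr (Subgroup.closure {γ : GL (Fin n × Fin n) ℂ | ∃ d e : Fin n → ℂˣ,
        (∀ i, (∏ k, (d k) ^ (Λ i (Sum.inl k))) * (∏ l, (e l) ^ (Λ i (Sum.inr l))) = 1) ∧
        (γ : Matrix (Fin n × Fin n) (Fin n × Fin n) ℂ) = Matrix.diagonal (fun p => (d p.1 : ℂ) * (e p.2 : ℂ))})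
      (perPoly (Fin n) ℂ) B →
    ∃ (P Q : GL (Fin m) ℂ) (r' : ℕ) (Λ' : Fin r' → (Fin n ⊕ Fin n) → ℤ) (α β : Fin m → (Fin n ⊕ Fin n) → ℤ),
      r' ≤ r ∧
      -- `Λ'` spans the saturation of `ℤΛ`: same rational span
      (∀ i, ∃ (c : ℤ) (z : Fin r' → ℤ), c ≠ 0 ∧ c • Λ i = ∑ t, z t • Λ' t) ∧
      (∀ t, ∃ (c : ℤ) (z : Fin r → ℤ), c ≠ 0 ∧ c • Λ' t = ∑ i, z i • Λ i) ∧
      IsAffineDetRepr (perPoly (Fin n) ℂ)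
        ((P : Matrix (Fin m) (Fin m) ℂ).map C * B * (Q : Matrix (Fin m) (Fin m) ℂ).map C) ∧
      (∀ i j, constPart ((P : Matrix (Fin m) (Fin m) ℂ).map C * B * (Q : Matrix (Fin m) (Fin m) ℂ).map C) i j ≠ 0 →
        ∃ z : Fin r' → ℤ, α i + β j = ∑ t, z t • Λ' t) ∧
      (∀ i j (p : Fin n × Fin n),
        LRPencil.coeffMat ((P : Matrix (Fin m) (Fin m) ℂ).map C * B * (Q : Matrix (Fin m) (Fin m) ℂ).map C) p i j ≠ 0 →
        ∃ z : Fin r' → ℤ,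
          α i + β j - ((Pi.single (Sum.inl p.1) 1 : Fin n ⊕ Fin n → ℤ) + Pi.single (Sum.inr p.2) 1) =
            ∑ t, z t • Λ' t)

end Summit.ValiantsHypothesis.ValiantsHypothesis.Cruxes.OrbitDimensionBound.Calibration

end
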